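import Mathlib.Topology.NoetherianSpace
import Mathlib.Topology.Sober
import Mathlib.Order.Preorder.Finite
import HarnessLib

/-!
# Specialisation-closures of generically stable sets are closed

Pure point-set topology used by the `SepExcModels` crux skeleton (line `birth`): the blow-up
centre `sharpCentre Y = {y | ∃ ζ ∈ sharpLocus Y, ζ ⤳ y}` must be closed, and the skeleton gets
that from the present lemma applied to `S = sharpLocus Y` (a Noetherian scheme is a Noetherian
quasi-sober space) together with propagation of bluntness (which supplies the hypothesis `hS`).

**Statement.** In a Noetherian quasi-sober space `α`, let `S ⊆ α` contain every point `w` with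
`w ∈ closure (S ∩ closure {w})`. Then `C := {y | ∃ ζ ∈ S, ζ ⤳ y} = ⋃_{ζ ∈ S} closure {ζ}` is
closed; in fact `C = closure S`.

**Proof.** `C ⊆ closure S` because `ζ ⤳ y` means `y ∈ closure {ζ} ⊆ closure S`. Conversely,
write the closed set `closure S` as a finite union `⋃₀ F` of irreducible closed sets
(`NoetherianSpace.exists_finite_set_isClosed_irreducible`). Given `y ∈ closure S`, choose
`Z ∈ F` containing `y` and maximal (for `⊆`) among the members of `F` containing `y`. Since
`S ⊆ ⋃₀ F`, `closure S ⊆ ⋃_{Z' ∈ F} closure (S ∩ Z')`, a finite union of closed sets, so the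
irreducible set `Z` lies in some `closure (S ∩ Z') ⊆ Z'`; then `y ∈ Z'`, hence `Z' ⊆ Z` by
maximality, and so `Z ⊆ closure (S ∩ Z)`. The generic point `w` of `Z` (quasi-sobriety:
`Z = closure {w}`) therefore lies in `closure (S ∩ closure {w})`, so `w ∈ S` by hypothesis, and
`w ⤳ y` because `y ∈ Z = closure {w}`. Hence `closure S ⊆ C`, and `C = closure S` is closed.
-/

-- single-problem summit: the doubled namespace component is forced
set_option linter.dupNamespace false

namespace Summit.ResolutionOfSingularities.ResolutionOfSingularities.Theorems.SepExcModels.SpecializationClosure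

open TopologicalSpace Topology

/-- The specialisation-closure `{y | ∃ ζ ∈ S, ζ ⤳ y}` of any set `S` is contained in
`closure S`: `ζ ⤳ y` means `y ∈ closure {ζ} ⊆ closure S`. [folklore] -/
private theorem specializationClosure_subset_closure {α : Type*} [TopologicalSpace α]
    (S : Set α) : {y : α | ∃ ζ ∈ S, ζ ⤳ y} ⊆ closure S := by
  rintro y ⟨ζ, hζS, hζy⟩
  exact closure_mono (Set.singleton_subset_iff.mpr hζS) (specializes_iff_mem_closure.mp hζy)

/-- Key step. In a Noetherian quasi-sober space, if `S` contains every point `w` lying in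
`closure (S ∩ closure {w})`, then every point of `closure S` is a specialisation of a point of
`S`: the generic points of the maximal irreducible pieces of `closure S` lie in `S`.
[folklore] -/
private theorem closure_subset_specializationClosure {α : Type*} [TopologicalSpace α]
    [NoetherianSpace α] [QuasiSober α] (S : Set α)
    (hS : ∀ w : α, w ∈ closure (S ∩ closure {w}) → w ∈ S) :
    closure S ⊆ {y : α | ∃ ζ ∈ S, ζ ⤳ y} := by
  classical
  intro y hy
  -- `closure S` is a finite union `⋃₀ F` of irreducible closed sets
  obtain ⟨F, hFfin, hFcl, hFirr, hF⟩ :=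
    NoetherianSpace.exists_finite_set_isClosed_irreducible (isClosed_closure (s := S))
  have hSF : closure S ⊆ ⋃₀ F := hF.le
  have hFS : ⋃₀ F ⊆ closure S := hF.ge
  -- `y` lies in one of the pieces; take such a piece `Z`, maximal among those containing `y`
  obtain ⟨Z₀, hZ₀F, hyZ₀⟩ : ∃ Z₀ ∈ F, y ∈ Z₀ := Set.mem_sUnion.mp (hSF hy)
  obtain ⟨Z, -, hZmax⟩ :=
    (hFfin.subset (Set.sep_subset F fun Z => y ∈ Z)).exists_le_maximal ⟨hZ₀F, hyZ₀⟩
  have hZF : Z ∈ F := hZmax.prop.1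
  have hyZ : y ∈ Z := hZmax.prop.2
  have hZirr : IsIrreducible Z := hFirr Z hZF
  have hZcl : IsClosed Z := hFcl Z hZF
  -- `closure S ⊆ ⋃_{Z' ∈ F} closure (S ∩ Z')`, a finite union of closed sets
  have hcov : closure S ⊆ ⋃ Z' ∈ F, closure (S ∩ Z') := by
    have h1 : S ⊆ ⋃ Z' ∈ F, S ∩ Z' := fun s hs => by
      obtain ⟨Z', hZ'F, hsZ'⟩ : ∃ Z' ∈ F, s ∈ Z' := Set.mem_sUnion.mp (hSF (subset_closure hs))
      exact Set.mem_biUnion hZ'F ⟨hs, hsZ'⟩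
    exact (closure_mono h1).trans (hFfin.closure_biUnion fun Z' => S ∩ Z').le
  -- the irreducible set `Z` lies in one of them
  obtain ⟨Z', hZ'F, hZZ'⟩ : ∃ Z' ∈ F, Z ⊆ closure (S ∩ Z') := by
    have hZsub : Z ⊆ ⋃₀ ↑(hFfin.toFinset.image fun Z' => closure (S ∩ Z')) := by
      rw [Finset.coe_image, hFfin.coe_toFinset, Set.sUnion_image]
      exact ((Set.subset_sUnion_of_mem hZF).trans hFS).trans hcov
    obtain ⟨T, hT, hZT⟩ := isIrreducible_iff_sUnion_isClosed.mp hZirr _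
      (fun T hT => by
        obtain ⟨Z', -, rfl⟩ := Finset.mem_image.mp hT
        exact isClosed_closure) hZsub
    obtain ⟨Z', hZ'F, rfl⟩ := Finset.mem_image.mp hT
    exact ⟨Z', hFfin.mem_toFinset.mp hZ'F, hZT⟩
  -- maximality of `Z`: `Z' ⊆ Z`, hence `Z ⊆ closure (S ∩ Z)`
  have hZZ'' : Z ⊆ Z' :=
    hZZ'.trans ((hFcl Z' hZ'F).closure_subset_iff.mpr Set.inter_subset_right)
  have hZ'Z : Z' ⊆ Z := hZmax.2 ⟨hZ'F, hZZ'' hyZ⟩ hZZ''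
  have hZS : Z ⊆ closure (S ∩ Z) :=
    hZZ'.trans (closure_mono (Set.inter_subset_inter_right S hZ'Z))
  -- the generic point `w` of `Z` lies in `closure (S ∩ closure {w})`, hence in `S`
  obtain ⟨w, hw⟩ : ∃ w, IsGenericPoint w Z := QuasiSober.sober hZirr hZcl
  have hwS : w ∈ S := by
    refine hS w ?_
    rw [hw.def]
    exact hZS hw.mem
  exact ⟨w, hwS, hw.specializes hyZ⟩

/-- **Specialisation-closures of generically stable sets are closed.** In a Noetherian
quasi-sober space, if a set `S` contains every point `w` that lies in the closure of
`S ∩ closure {w}`, then `{y | ∃ ζ ∈ S, ζ ⤳ y} = ⋃_{ζ ∈ S} closure {ζ}` is closed — it equals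
`closure S`. [folklore] -/
theorem stub_specializationClosure_isClosed (α : Type) [TopologicalSpace α]
    [NoetherianSpace α] [QuasiSober α] (S : Set α)
    (hS : ∀ w : α, w ∈ closure (S ∩ closure {w}) → w ∈ S) :
    IsClosed {y : α | ∃ ζ ∈ S, ζ ⤳ y} := by
  have h : {y : α | ∃ ζ ∈ S, ζ ⤳ y} = closure S :=
    Set.Subset.antisymm (specializationClosure_subset_closure S)
      (closure_subset_specializationClosure S hS)
  rw [h]
  exact isClosed_closure

end Summit.ResolutionOfSingularities.ResolutionOfSingularities.Theorems.SepExcModels.SpecializationClosure
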